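import Summits.NavierStokesRegularity.NavierStokesRegularity.Theorems.TerminalTraceTraceDensityCriterionLocalTypeIZoomData
import Summits.NavierStokesRegularity.NavierStokesRegularity.Theorems.TerminalTraceTypeITraceScarL3StubExtinctApexOfL3Trace
import Summits.NavierStokesRegularity.NavierStokesRegularity.Theorems.TerminalTraceTypeITraceScarL3
import Summits.NavierStokesRegularity.NavierStokesRegularity.Theorems.TerminalTraceTraceDensityCriterionTypeIIff
import Literature.Analysis.FluidPDE.LocalPlainPressureBound
import Literature.Analysis.FluidPDE.NSViscosityRescaling
import Literature.Analysis.FluidPDE.NSLerayHopfABCScaling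
import HarnessLib

/-!
# Crux `TerminalTrace.TraceDensityCriterion` (stmt-NavierStokesRegularity-18614): its LOCAL Type-I cell, DOOR FORMAT —
# at a locally Type-I vertex, vanishing scaled energy of the final value forces regularity

Seat nsreg-C26-p1 g6 (cell ns-regularity-ideate), `--supports stmt-NavierStokesRegularity-18614` (helper; closes nothing).
The doors of the cell (`HalfSpaceWindowDoor.Target`, `UnthreadedDoor.Target`, `PoloidalWindowDoor.Target`, …) all read:
frame (`ν, T > 0`, classical on `[0, T)`, Leray–Hopf on `[0, T]`, rapidly decaying datum) → at a vertex `x₀` with the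
LOCAL Type-I rate `‖u(t,x)‖ √(ν(T−t)) ≤ M` on `(T − ρ², T) × B(x₀, ρ)` → [door condition] → `IsBackwardBoundedAt u T x₀`.
THIS FILE proves the door whose condition is the vanishing of the scaled energy of the FINAL VALUE at `x₀`
(`r⁻¹ ∫_{B(x₀,r)} ‖u T‖² → 0`), i.e. the local form of the landed Type-I cell of the crux
(`TerminalTrace.typeI_traceDensityCriterion`, p652624, which assumed the GLOBAL rate `IsTypeIBlowup u T`):

* `TraceDensityCriterion.extinctApexD_unit_of_localTypeI` (`ν = 1`) / `…extinctApexD_of_localTypeI` (every `ν`, by the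
  normalisation `v(s, x) = ν⁻¹ u(s/ν, x)`) — at a locally Type-I vertex that is NOT backward bounded, FE(x₀) produces an
  EXTINCT TYPE-I APEX (suitable in every `Q(a)`, 𝐈 ≤ M, plain D ≤ D₀ at every apex, rate `C/√(−s)`, weakly vanishing top
  trace, backward-singular origin) — over the door tool-kit (`exists_zoom_typeIBound_lt_top_of_localTypeI`,
  `ae_rate_of_zoomLimit_of_ball`) via `exists_extinctApex_zoomData_unit_of_localTypeI`;
* `TerminalTrace.localTypeI_traceDensityCriterion` — **the door**: frame → local rate at `x₀` → FE(x₀) →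
  `IsBackwardBoundedAt u T x₀` (no extinct apex is backward singular, `TypeITraceScarL3.no_singular_extinctApex`);
* `TerminalTrace.localTypeI_isBackwardBoundedAt_iff_tendsto_scaledEnergy`,
  `TerminalTrace.localTypeI_singular_iff_not_tendsto_scaledEnergy` — at a locally Type-I vertex, backward boundedness
  (resp. backward singularity) is EQUIVALENT to the vanishing (resp. non-vanishing) of the final scaled energy.

WHAT THIS IS NOT: not NS regularity (Clay A), not the crux (no rate there), not a registered door item (none is filed for
this condition; offered to the door planners as a closed-at-birth rung); theorems about HYPOTHETICAL locally Type-I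
blow-ups.  [folklore; EscauriazaSereginSverak2003 §3; AlbrittonBarker2019 §3, Lemma 2.5; SereginSverak2002 Thm. 2.2, §4]
-/

noncomputable section

set_option linter.dupNamespace false

namespace Summit.NavierStokesRegularity.NavierStokesRegularity.Theorems

open MeasureTheory Set Function Filter Topology TopologicalSpace Metric
open Literature.Analysis.FluidPDE
open Summit.NavierStokesRegularity.NavierStokesRegularity.Theorems.TypeITraceScarL3
open Summit.NavierStokesRegularity.NavierStokesRegularity.Theorems.LocalSineTubeDoorLocalPointZoomZoom
open scoped NNReal ENNReal InnerProductSpace RealInnerProductSpace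

namespace TraceDensityCriterion

/-- **The extinct Type-I apex at a LOCALLY Type-I vertex with vanishing final scaled energy, unit viscosity.** `T > 0`,
`(u, p)` classical on `ℝ³ × [0, T)` (`ν = 1`) and Leray–Hopf on `[0, T]`, local rate `‖u(t,x)‖ √(T−t) ≤ M_r` on
`(T − ρ², T) × B(x₀, ρ)`, NOT backward bounded at `(T, x₀)`,
with `r⁻¹ ∫_{B(x₀,r)} ‖u T‖² → 0`: then there is an extinct Type-I apex `(U, P, G, M, D₀, C)` — suitable in every
`Q(a)` with weak gradient `G`, `𝐈(Q(a)) ≤ M`, PLAIN `D(Q_r(z₀))[P] ≤ D₀` at every apex `z₀.1 ≤ 0` and every radius,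
rate `C/√(−s)` a.e. on every slice, weakly vanishing at the top time, backward-singular at the origin.
[folklore; AlbrittonBarker2019 §3; SereginSverak2009 (as13); WangZhang2016 §4; Seregin2014 §6.6] -/
theorem extinctApexD_unit_of_localTypeI {T : ℝ} (hT : 0 < T)
    {u : ℝ → EuclideanSpace ℝ (Fin 3) → EuclideanSpace ℝ (Fin 3)} {p : ℝ → EuclideanSpace ℝ (Fin 3) → ℝ}
    (hsol : IsClassicalNSSolutionOn (Ico 0 T) 1 0 u p) (hLH : IsLerayHopfOn T 1 0 (u 0) u)
    {x₀ : EuclideanSpace ℝ (Fin 3)} {ρ Mr : ℝ} (hρ : 0 < ρ)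
    (hM : ∀ t ∈ Ico 0 T, T - ρ ^ 2 < t → ∀ x ∈ ball x₀ ρ, ‖u t x‖ * Real.sqrt (1 * (T - t)) ≤ Mr)
    (hnotbd : ¬ IsBackwardBoundedAt u T x₀)
    (hFE : Tendsto (fun r : ℝ => r⁻¹ * ∫ x in ball x₀ r, ‖u T x‖ ^ 2) (𝓝[>] 0) (𝓝 0)) :
    ∃ (U : ℝ → EuclideanSpace ℝ (Fin 3) → EuclideanSpace ℝ (Fin 3)) (P : ℝ → EuclideanSpace ℝ (Fin 3) → ℝ)
      (G : ℝ → EuclideanSpace ℝ (Fin 3) → EuclideanSpace ℝ (Fin 3) →L[ℝ] EuclideanSpace ℝ (Fin 3))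
      (M D₀ : ℝ≥0) (C : ℝ),
      (∀ a : ℝ, 0 < a → IsSuitableWeakSolutionInBall a (0 : ℝ × EuclideanSpace ℝ (Fin 3)) U P) ∧
      (∀ a : ℝ, 0 < a →
        HasWeakSpatialGradientOn (parabolicCylinderOpens a (0 : ℝ × EuclideanSpace ℝ (Fin 3))) U G) ∧
      (∀ a : ℝ, 0 < a → typeIBound (parabolicCylinder a (0 : ℝ × EuclideanSpace ℝ (Fin 3))) U P G ≤ M) ∧
      (∀ z₀ : ℝ × EuclideanSpace ℝ (Fin 3), z₀.1 ≤ 0 → ∀ r : ℝ, 0 < r → cknD r z₀ P ≤ D₀) ∧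
      (∀ s : ℝ, s < 0 → ∀ᵐ y : EuclideanSpace ℝ (Fin 3), ‖U s y‖ ≤ C / Real.sqrt (-s)) ∧
      (∀ φ : EuclideanSpace ℝ (Fin 3) → EuclideanSpace ℝ (Fin 3), ContDiff ℝ (⊤ : ℕ∞) φ →
        HasCompactSupport φ → ∀ ε : ℝ, 0 < ε →
          ∃ s₀ : ℝ, s₀ < 0 ∧ ∀ᵐ s ∂(volume.restrict (Ioo s₀ 0)), |∫ y, ⟪U s y, φ y⟫| ≤ ε) ∧
      IsBackwardSingularPoint U (0 : ℝ × EuclideanSpace ℝ (Fin 3)) := by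
  -- adapted VERBATIM from Theorems/TerminalTraceTraceDensityCriterionTypeI.lean (`extinctApexD_unit_of_scaledEnergy`)
  -- ## (1) the apex with its zoom data
  obtain ⟨μ, U, P, G, M, C, hμ, hμ0, h1, h2, h3, h4, h5, h6, hdata⟩ :=
    exists_extinctApex_zoomData_unit_of_localTypeI hT hsol hLH hρ hM hnotbd hFE
  -- ## (2) the vertex frame: `v = R u(T + R²·, x₀ + R·)`, `πv = R² q(…)`, with `𝐈(Q(0,1/2)) < ⊤`
  obtain ⟨R, α, β, hR, hα, hβ, hβeq, hαeq, hβT, -, -, hball, hGv, -, htypeI⟩ :=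
    exists_zoom_typeIBound_lt_top_of_localTypeI one_pos hT hsol hLH hρ hM
  rw [div_one] at hβeq hαeq
  set q : ℝ → EuclideanSpace ℝ (Fin 3) → ℝ :=
    fun t x => p t x - (p t 0 - normalisedPressure (u t) 0) with hq
  set v : ℝ → EuclideanSpace ℝ (Fin 3) → EuclideanSpace ℝ (Fin 3) := α • stPull β R T x₀ u with hv
  set πv : ℝ → EuclideanSpace ℝ (Fin 3) → ℝ := α ^ 2 • stPull β R T x₀ q with hπv
  set Gv : ℝ → EuclideanSpace ℝ (Fin 3) → EuclideanSpace ℝ (Fin 3) →L[ℝ] EuclideanSpace ℝ (Fin 3) :=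
    (α * R) • stPull β R T x₀ (fun t x => fderiv ℝ (u t) x) with hGvdef
  have hπv1 : πv = R ^ 2 • stPull (R ^ 2) R T x₀ q := by rw [hπv, hαeq, hβeq]
  set z₀ : ℝ × EuclideanSpace ℝ (Fin 3) := ((0 : ℝ), (0 : EuclideanSpace ℝ (Fin 3))) with hz₀
  have hz₀0 : z₀ = 0 := rfl
  -- the distributional pair on `Q(0,1)` and the sub-cylinder `Q(0, 1/2)`
  have hdist : IsDistributionalNSSolutionOn
      (parabolicCylinderOpens 1 (0 : ℝ × EuclideanSpace ℝ (Fin 3))) 1 0 v πv := hball.1.distributional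
  have hsub : parabolicCylinder (1 / 2) z₀ ⊆
      ((parabolicCylinderOpens 1 (0 : ℝ × EuclideanSpace ℝ (Fin 3)) :
        Opens (ℝ × EuclideanSpace ℝ (Fin 3))) : Set (ℝ × EuclideanSpace ℝ (Fin 3))) := by
    rw [coe_parabolicCylinderOpens, hz₀0]
    exact SuitableCompactness.parabolicCylinder_zero_mono (by norm_num) (by norm_num)
  -- `M₁ = 𝐈(Q(0, 1/2))` bounds `C` on every sub-cylinder
  set M₁ : ℝ≥0∞ := typeIBound (parabolicCylinder (1 / 2) (0 : ℝ × EuclideanSpace ℝ (Fin 3))) v πv Gv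
    with hM₁
  have hM₁top : M₁ ≠ ⊤ := htypeI.ne
  have hC : ∀ (z : ℝ × EuclideanSpace ℝ (Fin 3)) (r : ℝ), 0 < r →
      parabolicCylinder r z ⊆ parabolicCylinder (1 / 2) z₀ → cknC r z v ≤ M₁ := by
    intro z r hr hz
    rw [hz₀0] at hz
    exact cknC_le_of_typeIBound_le (le_refl M₁) subset_rfl hr hz
  -- `M₂ = D(Q(0, 1/2))[πv]` is finite (`πv ∈ L^{3/2}(Q(0,1))`)
  set M₂ : ℝ≥0∞ := cknD (1 / 2) z₀ πv with hM₂
  have hM₂top : M₂ ≠ ⊤ := by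
    obtain ⟨h32, h32', h32r⟩ := threeHalves_facts
    have hm : MemLp (uncurry πv) (3 / 2)
        (volume.restrict (parabolicCylinder 1 (0 : ℝ × EuclideanSpace ℝ (Fin 3)))) := hball.2.2.2
    have h2 := hm.2
    rw [eLpNorm_eq_lintegral_rpow_enorm_toReal (by norm_num) h32', h32r] at h2
    have hfin : ∫⁻ z in parabolicCylinder 1 (0 : ℝ × EuclideanSpace ℝ (Fin 3)),
        ‖uncurry πv z‖ₑ ^ (3 / 2 : ℝ) < ⊤ := by
      by_contra htop
      rw [not_lt, top_le_iff] at htop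
      rw [htop, ENNReal.top_rpow_of_pos (by norm_num)] at h2
      exact lt_irrefl _ h2
    have hfin' : ∫⁻ z in parabolicCylinder (1 / 2) z₀, ‖πv z.1 z.2‖ₑ ^ (3 / 2 : ℝ) < ⊤ := by
      refine lt_of_le_of_lt (lintegral_mono_set ?_) hfin
      rw [hz₀0]
      exact SuitableCompactness.parabolicCylinder_zero_mono (by norm_num) (by norm_num)
    rw [hM₂, cknD]
    exact ENNReal.mul_ne_top (ENNReal.inv_ne_top.2 (pow_ne_zero _ (by simp))) hfin'.ne
  -- ## (3) Seregin–Šverák's iterated pressure decay: plain `D ≤ κ(M₁ + M₂)` on the window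
  obtain ⟨κ, hκ⟩ := exists_cknD_le_window_of_cknC_le
  set K : ℝ≥0∞ := κ * (M₁ + M₂) with hK
  have hKtop : K ≠ ⊤ := ENNReal.mul_ne_top ENNReal.coe_ne_top (ENNReal.add_ne_top.2 ⟨hM₁top, hM₂top⟩)
  have hwin : ∀ z : ℝ × EuclideanSpace ℝ (Fin 3), z.1 ≤ z₀.1 → z₀.1 - 3 / 16 ≤ z.1 →
      dist z.2 z₀.2 < 1 / 4 → ∀ r ∈ Ioc (0 : ℝ) (1 / 4), cknD r z πv ≤ K := by
    intro z hz1 hz2 hz3 r hr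
    have h := hκ (parabolicCylinderOpens 1 (0 : ℝ × EuclideanSpace ℝ (Fin 3))) v πv hdist z₀ (1 / 2)
      (by norm_num) hsub M₁ M₂ hC le_rfl z hz1 (by norm_num at hz2 ⊢; linarith) (by norm_num; exact hz3)
      r ⟨hr.1, by norm_num; exact hr.2⟩
    rw [hK]
    exact h
  -- ## (4) the zoomed pressures of the zoom data are `(μ_j/R)`-zooms of `πv`
  set lam : ℕ → ℝ := fun j => μ j / R with hlam
  have hlampos : ∀ j, 0 < lam j := fun j => show 0 < μ j / R from div_pos (hμ j) hR
  have hlam0 : Tendsto lam atTop (𝓝 0) := by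
    have := hμ0.div_const R
    rwa [zero_div] at this
  have hzoomπ : ∀ j, (lam j) ^ 2 • stPull ((lam j) ^ 2) (lam j) z₀.1 z₀.2 πv =
      (μ j) ^ 2 • stPull ((μ j) ^ 2) (μ j) T x₀ q := by
    intro j
    have e : lam j * R = μ j := by rw [hlam]; field_simp
    show (lam j) ^ 2 • stPull ((lam j) ^ 2) (lam j) (0 : ℝ) (0 : EuclideanSpace ℝ (Fin 3)) πv = _
    rw [hπv1, zoom_zoom_pressure, e]
  have hpm : AEStronglyMeasurable (uncurry πv) (volume.restrict (parabolicCylinder (1 / 2) z₀)) :=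
    hball.2.2.2.1.mono_measure (Measure.restrict_mono (by rwa [coe_parabolicCylinderOpens] at hsub) le_rfl)
  have hπ : ∀ a : ℝ, 0 < a → MemLp (uncurry P) (3 / 2)
      (volume.restrict (parabolicCylinder a (0 : ℝ × EuclideanSpace ℝ (Fin 3)))) :=
    fun a ha => (hdata a ha).2.1
  have hweak : ∀ a : ℝ, 0 < a → ∀ g : ℝ × EuclideanSpace ℝ (Fin 3) → ℝ,
      MemLp g 3 (volume.restrict (parabolicCylinder a (0 : ℝ × EuclideanSpace ℝ (Fin 3)))) →
      Tendsto (fun j => ∫ w' in parabolicCylinder a (0 : ℝ × EuclideanSpace ℝ (Fin 3)),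
          ((lam j) ^ 2 • stPull ((lam j) ^ 2) (lam j) z₀.1 z₀.2 πv) w'.1 w'.2 * g w')
        atTop (𝓝 (∫ w' in parabolicCylinder a (0 : ℝ × EuclideanSpace ℝ (Fin 3)), P w'.1 w'.2 * g w')) := by
    intro a ha g hg
    simp only [hzoomπ]
    exact (hdata a ha).2.2.2 g hg
  -- ## (5) weak lower semicontinuity: the limit pressure inherits `D ≤ K` at every apex
  have hvi : ∀ z : ℝ × EuclideanSpace ℝ (Fin 3), z.1 ≤ 0 → ∀ r : ℝ, 0 < r → cknD r z P ≤ K :=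
    fun z hz r hr => blowup_cknD_le_apex_of_tendsto hpm (by norm_num : (0 : ℝ) < 3 / 16)
      (by norm_num : (0 : ℝ) < 1 / 4) (by norm_num : (0 : ℝ) < 1 / 4) hwin hlampos hlam0 hπ hweak hz hr
  -- ## (6) assemble, with `D₀ = K` as a finite constant
  refine ⟨U, P, G, M, K.toNNReal, C, h1, h2, h3, ?_, h4, h5, h6⟩
  intro z hz r hr
  rw [ENNReal.coe_toNNReal hKtop]
  exact hvi z hz r hr


/-- **The extinct Type-I apex at a LOCALLY Type-I vertex with vanishing final scaled energy, every viscosity** (door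
hypotheses): frame (`ν, T > 0`, classical on `[0, T)`, Leray–Hopf on `[0, T]`), local rate `‖u(t,x)‖ √(ν(T−t)) ≤ M` on
`(T − ρ², T) × B(x₀, ρ)`, `(T, x₀)` NOT backward bounded, `r⁻¹ ∫_{B(x₀,r)} ‖u T‖² → 0` ⇒ an extinct Type-I apex with the
seven clauses of `extinctApexD_unit_of_localTypeI` (normalisation `v(s, x) = ν⁻¹ u(s/ν, x)`, blow-up time `νT`, local
radius `min ρ (√ν ρ)`). [folklore; AlbrittonBarker2019 §3; Seregin2014 §6.6 Prop. 6.20] -/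
theorem extinctApexD_of_localTypeI {ν T : ℝ} (hν : 0 < ν) (hT : 0 < T)
    {u : ℝ → EuclideanSpace ℝ (Fin 3) → EuclideanSpace ℝ (Fin 3)} {p : ℝ → EuclideanSpace ℝ (Fin 3) → ℝ}
    (hcl : IsClassicalNSSolutionOn (Ico 0 T) ν 0 u p) (hLH : IsLerayHopfOn T ν 0 (u 0) u)
    {x₀ : EuclideanSpace ℝ (Fin 3)} {ρ M : ℝ} (hρ : 0 < ρ)
    (hM : ∀ t ∈ Ico 0 T, T - ρ ^ 2 < t → ∀ x ∈ ball x₀ ρ, ‖u t x‖ * Real.sqrt (ν * (T - t)) ≤ M)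
    (hnotbd : ¬ IsBackwardBoundedAt u T x₀)
    (hFE : Tendsto (fun r : ℝ => r⁻¹ * ∫ x in ball x₀ r, ‖u T x‖ ^ 2) (𝓝[>] 0) (𝓝 0)) :
    ∃ (U : ℝ → EuclideanSpace ℝ (Fin 3) → EuclideanSpace ℝ (Fin 3)) (P : ℝ → EuclideanSpace ℝ (Fin 3) → ℝ)
      (G : ℝ → EuclideanSpace ℝ (Fin 3) → EuclideanSpace ℝ (Fin 3) →L[ℝ] EuclideanSpace ℝ (Fin 3))
      (M' D₀ : ℝ≥0) (C : ℝ),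
      (∀ a : ℝ, 0 < a → IsSuitableWeakSolutionInBall a (0 : ℝ × EuclideanSpace ℝ (Fin 3)) U P) ∧
      (∀ a : ℝ, 0 < a →
        HasWeakSpatialGradientOn (parabolicCylinderOpens a (0 : ℝ × EuclideanSpace ℝ (Fin 3))) U G) ∧
      (∀ a : ℝ, 0 < a → typeIBound (parabolicCylinder a (0 : ℝ × EuclideanSpace ℝ (Fin 3))) U P G ≤ M') ∧
      (∀ z₀ : ℝ × EuclideanSpace ℝ (Fin 3), z₀.1 ≤ 0 → ∀ r : ℝ, 0 < r → cknD r z₀ P ≤ D₀) ∧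
      (∀ s : ℝ, s < 0 → ∀ᵐ y : EuclideanSpace ℝ (Fin 3), ‖U s y‖ ≤ C / Real.sqrt (-s)) ∧
      (∀ φ : EuclideanSpace ℝ (Fin 3) → EuclideanSpace ℝ (Fin 3), ContDiff ℝ (⊤ : ℕ∞) φ →
        HasCompactSupport φ → ∀ ε : ℝ, 0 < ε →
          ∃ s₀ : ℝ, s₀ < 0 ∧ ∀ᵐ s ∂(volume.restrict (Ioo s₀ 0)), |∫ y, ⟪U s y, φ y⟫| ≤ ε) ∧
      IsBackwardSingularPoint U (0 : ℝ × EuclideanSpace ℝ (Fin 3)) := by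
  -- adapted from `TraceDensityCriterion.extinctApexD_of_scaledEnergy` (viscosity normalisation), with the LOCAL rate
  have hν0 : ν ≠ 0 := hν.ne'
  have hνi : 0 < ν⁻¹ := inv_pos.2 hν
  have hνT : 0 < ν * T := mul_pos hν hT
  set v : ℝ → EuclideanSpace ℝ (Fin 3) → EuclideanSpace ℝ (Fin 3) := timeRescale ν⁻¹ ν⁻¹ u with hv
  set pv : ℝ → EuclideanSpace ℝ (Fin 3) → ℝ := timeRescale ν⁻¹ (ν⁻¹ ^ 2) p with hpv
  have hmaps : MapsTo (fun s => ν⁻¹ * s) (Ico 0 (ν * T)) (Ico 0 T) := by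
    intro s hs
    refine ⟨mul_nonneg hνi.le hs.1, ?_⟩
    calc ν⁻¹ * s < ν⁻¹ * (ν * T) := mul_lt_mul_of_pos_left hs.2 hνi
      _ = T := by rw [← mul_assoc, inv_mul_cancel₀ hν0, one_mul]
  -- (1) classical at viscosity 1 on `[0, νT)`
  have hclv : IsClassicalNSSolutionOn (Ico 0 (ν * T)) 1 0 v pv := by
    have h := hcl.viscosityRescale_set hν0 hmaps (uniqueDiffOn_Ico 0 (ν * T))
    rwa [timeRescale_zero_force] at h
  -- (2) Leray–Hopf on `[0, νT]`
  have hv0 : ν⁻¹ • u 0 = v 0 := by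
    funext x
    simp [hv]
  have hLHv : IsLerayHopfOn (ν * T) 1 0 (v 0) v := by
    have h := hLH.viscosityRescale hνi
    have e1 : T / ν⁻¹ = ν * T := by rw [div_inv_eq_mul, mul_comm]
    rwa [e1, inv_mul_cancel₀ hν0, timeRescale_zero_force, hv0] at h
  -- (3) the LOCAL rate of `v` at `(νT, x₀)` on the radius `ρ₁ = min ρ (√ν ρ)` (`ρ₁ ≤ ρ`, `ρ₁² ≤ ν ρ²`)
  set ρ₁ : ℝ := min ρ (Real.sqrt ν * ρ) with hρ₁
  have hρ₁pos : 0 < ρ₁ := lt_min hρ (by positivity)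
  have hρ₁ρ : ρ₁ ≤ ρ := min_le_left _ _
  have hρ₁sq : ρ₁ ^ 2 ≤ ν * ρ ^ 2 := by
    have h1 : ρ₁ ≤ Real.sqrt ν * ρ := min_le_right _ _
    have h2 : ρ₁ ^ 2 ≤ (Real.sqrt ν * ρ) ^ 2 := pow_le_pow_left₀ hρ₁pos.le h1 2
    rw [mul_pow, Real.sq_sqrt hν.le] at h2
    exact h2
  have hMv : ∀ s ∈ Ico 0 (ν * T), ν * T - ρ₁ ^ 2 < s → ∀ x ∈ ball x₀ ρ₁,
      ‖v s x‖ * Real.sqrt (1 * (ν * T - s)) ≤ ν⁻¹ * M := by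
    intro s hs hsρ x hx
    have htI : ν⁻¹ * s ∈ Ico 0 T := hmaps hs
    have htρ : T - ρ ^ 2 < ν⁻¹ * s := by
      have h1 : ν * T - ν * ρ ^ 2 < s := by linarith
      have h2 : ν * (T - ρ ^ 2) < ν * (ν⁻¹ * s) := by
        rw [← mul_assoc, mul_inv_cancel₀ hν0, one_mul]; linarith
      exact lt_of_mul_lt_mul_left h2 hν.le
    have hb := hM (ν⁻¹ * s) htI htρ x (ball_subset_ball hρ₁ρ hx)
    have e1 : ν * (T - ν⁻¹ * s) = ν * T - s := by field_simp
    rw [e1] at hb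
    have e2 : ‖v s x‖ = ν⁻¹ * ‖u (ν⁻¹ * s) x‖ := by
      rw [hv, timeRescale_apply, norm_smul, Real.norm_eq_abs, abs_of_pos hνi]
    rw [one_mul, e2, mul_assoc]
    exact mul_le_mul_of_nonneg_left hb hνi.le
  -- (4) the vertex is not backward bounded for `v`
  have hnotbdv : ¬ IsBackwardBoundedAt v (ν * T) x₀ := not_isBackwardBoundedAt_viscosityRescale hν hnotbd
  -- (5) the scaled energy of the final value `v(νT) = ν⁻¹ u(T)` vanishes at `x₀`
  have hFEv : Tendsto (fun r : ℝ => r⁻¹ * ∫ x in ball x₀ r, ‖v (ν * T) x‖ ^ 2) (𝓝[>] 0) (𝓝 0) := by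
    have e : v (ν * T) = ν⁻¹ • u T := by
      funext x
      rw [hv, timeRescale_apply, ← mul_assoc, inv_mul_cancel₀ hν0, one_mul, Pi.smul_apply]
    rw [e]
    exact SereginSverak2002.tendsto_scaledEnergy_const_smul hFE ν⁻¹
  -- ## the unit-viscosity theorem
  exact extinctApexD_unit_of_localTypeI hνT hclv hLHv hρ₁pos hMv hnotbdv hFEv

end TraceDensityCriterion

/-- **THE FINAL-DENSITY DOOR (local Type-I cell of crux stmt-NavierStokesRegularity-18614, door format).**  In the frame of
the cell's doors (`ν, T > 0`, `(u, p)` classical on `[0, T) × ℝ³`, Leray–Hopf on `[0, T]`, rapidly decaying datum), at a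
vertex `x₀` carrying the LOCAL Type-I rate `‖u(t,x)‖ √(ν(T−t)) ≤ M` on `(T − ρ², T) × B(x₀, ρ)`: if the final value has no
scaled-energy concentration at `x₀` (`r⁻¹ ∫_{B(x₀,r)} ‖u T‖² → 0`), then `(T, x₀)` is backward bounded.  Proof: otherwise
`TraceDensityCriterion.extinctApexD_of_localTypeI` yields an extinct Type-I apex backward-singular at the origin, and
there is none (`TypeITraceScarL3.no_singular_extinctApex`).  Same shape as `HalfSpaceWindowDoor.Target` with the window
condition replaced by FE(x₀). [folklore; EscauriazaSereginSverak2003 §3; AlbrittonBarker2019 §3] -/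
theorem TerminalTrace.localTypeI_traceDensityCriterion :
    ∀ (ν T : ℝ), 0 < ν → 0 < T →
      ∀ (u : ℝ → EuclideanSpace ℝ (Fin 3) → EuclideanSpace ℝ (Fin 3)) (p : ℝ → EuclideanSpace ℝ (Fin 3) → ℝ),
      IsClassicalNSSolutionOn (Ico 0 T) ν 0 u p → IsLerayHopfOn T ν 0 (u 0) u → HasRapidSpatialDecay (u 0) →
      ∀ (x₀ : EuclideanSpace ℝ (Fin 3)) (ρ M : ℝ), 0 < ρ →
      (∀ t ∈ Ico 0 T, T - ρ ^ 2 < t → ∀ x ∈ ball x₀ ρ, ‖u t x‖ * Real.sqrt (ν * (T - t)) ≤ M) →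
      Tendsto (fun r : ℝ => r⁻¹ * ∫ x in ball x₀ r, ‖u T x‖ ^ 2) (𝓝[>] 0) (𝓝 0) →
      IsBackwardBoundedAt u T x₀ := by
  intro ν T hν hT u p hcl hLH _hdec x₀ ρ M hρ hM hFE
  by_contra hnotbd
  obtain ⟨U, P, G, M', D₀, C, hsw, hG, hI, hD, hrate, htop, hsingU⟩ :=
    TraceDensityCriterion.extinctApexD_of_localTypeI hν hT hcl hLH hρ hM hnotbd hFE
  exact TypeITraceScarL3.no_singular_extinctApex U P G M' D₀ C hsw hG hI hD hrate htop hsingU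

/-- **At a locally Type-I vertex, backward boundedness ⟺ vanishing final scaled energy** (the rate-free «⇒» is
`SereginSverak2002.tendsto_scaledEnergy_final_of_isBackwardBoundedAt`; «⇐» is the door).
[cite: SereginSverak2002, Thm. 2.2 (p. 70)] [folklore; EscauriazaSereginSverak2003 §3] -/
theorem TerminalTrace.localTypeI_isBackwardBoundedAt_iff_tendsto_scaledEnergy {ν T : ℝ} (hν : 0 < ν) (hT : 0 < T)
    {u : ℝ → EuclideanSpace ℝ (Fin 3) → EuclideanSpace ℝ (Fin 3)} {p : ℝ → EuclideanSpace ℝ (Fin 3) → ℝ}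
    (hcl : IsClassicalNSSolutionOn (Ico 0 T) ν 0 u p) (hLH : IsLerayHopfOn T ν 0 (u 0) u)
    (hdec : HasRapidSpatialDecay (u 0)) {x₀ : EuclideanSpace ℝ (Fin 3)} {ρ M : ℝ} (hρ : 0 < ρ)
    (hM : ∀ t ∈ Ico 0 T, T - ρ ^ 2 < t → ∀ x ∈ ball x₀ ρ, ‖u t x‖ * Real.sqrt (ν * (T - t)) ≤ M) :
    IsBackwardBoundedAt u T x₀ ↔
      Tendsto (fun r : ℝ => r⁻¹ * ∫ x in ball x₀ r, ‖u T x‖ ^ 2) (𝓝[>] 0) (𝓝 0) :=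
  ⟨SereginSverak2002.tendsto_scaledEnergy_final_of_isBackwardBoundedAt hT hLH,
    TerminalTrace.localTypeI_traceDensityCriterion ν T hν hT u p hcl hLH hdec x₀ ρ M hρ hM⟩

/-- **At a locally Type-I vertex, backward singularity ⟺ a density scar of the final value**: `u` is essentially
unbounded on every `Q_r(T, x₀)` iff `r⁻¹ ∫_{B(x₀,r)} ‖u T‖²` does NOT tend to `0`.
[folklore; EscauriazaSereginSverak2003 §3; SereginSverak2002 Thm. 2.2] -/
theorem TerminalTrace.localTypeI_singular_iff_not_tendsto_scaledEnergy {ν T : ℝ} (hν : 0 < ν) (hT : 0 < T)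
    {u : ℝ → EuclideanSpace ℝ (Fin 3) → EuclideanSpace ℝ (Fin 3)} {p : ℝ → EuclideanSpace ℝ (Fin 3) → ℝ}
    (hcl : IsClassicalNSSolutionOn (Ico 0 T) ν 0 u p) (hLH : IsLerayHopfOn T ν 0 (u 0) u)
    (hdec : HasRapidSpatialDecay (u 0)) {x₀ : EuclideanSpace ℝ (Fin 3)} {ρ M : ℝ} (hρ : 0 < ρ)
    (hM : ∀ t ∈ Ico 0 T, T - ρ ^ 2 < t → ∀ x ∈ ball x₀ ρ, ‖u t x‖ * Real.sqrt (ν * (T - t)) ≤ M) :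
    (∀ r : ℝ, 0 < r → eLpNorm (uncurry u) ⊤ (volume.restrict (parabolicCylinder r (T, x₀))) = ⊤) ↔
      ¬ Tendsto (fun r : ℝ => r⁻¹ * ∫ x in ball x₀ r, ‖u T x‖ ^ 2) (𝓝[>] 0) (𝓝 0) := by
  rw [← TerminalTrace.localTypeI_isBackwardBoundedAt_iff_tendsto_scaledEnergy hν hT hcl hLH hdec hρ hM]
  refine ⟨fun hsing hbb => ?_, fun hnot r hr => ?_⟩
  · obtain ⟨r, hr, hfin⟩ := hbb.eLpNorm_parabolicCylinder_lt_top
    exact hfin.ne (hsing r hr)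
  · by_contra hne
    exact hnot (TerminalTrace.isBackwardBoundedAt_of_eLpNorm_lt_top hT hcl hr (lt_top_iff_ne_top.2 hne))

end Summit.NavierStokesRegularity.NavierStokesRegularity.Theorems

end
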